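import Mathlib.Combinatorics.SimpleGraph.Connectivity.Connected
import Literature.MathematicalPhysics.QuantumLattice.LiebMattisMatrixElements
import Literature.MathematicalPhysics.QuantumLattice.PerronFrobeniusGroundState
import Literature.MathematicalPhysics.QuantumLattice.SectorSpectrum
import Literature.MathematicalPhysics.QuantumLattice.SectorEigenvalueContinuation
import HarnessLib

/-!
# Perron–Frobenius in the magnetisation sectors of the Heisenberg antiferromagnet (Lieb–Mattis)

Sibling proof file (theorems only, no definitions) of
`Literature/MathematicalPhysics/QuantumLattice/SpinChains.lean`, third of the files discharging
the named fact `marshall_lieb_mattis_spin` (Lieb–Mattis, J. Math. Phys. 3 (1962) 749, Thm 2;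
Tasaki (2020) Thm 2.3). For the spin-`n/2` Heisenberg antiferromagnet `H = J Σ_{edges} 𝐒_x · 𝐒_y`,
`J > 0`, on a finite connected graph which is bipartite with parts `A`, `Aᶜ`:

* **ergodicity**: any two basis configurations of the same weight `W = Σ_x σ_x` are joined by a
  chain of nonzero matrix elements of `H` (hops of one unit of `Sᶻ` along edges; an occupied
  intermediate site is emptied first — induction along a walk of the connected graph)
  (`reflTransGen_of_weight_eq`);
* **Perron–Frobenius in each sector** (`sector_perronFrobenius`): in every nonempty magnetisation
  sector the lowest energy `E(M) = lowestEnergyInSector` is attained, the eigenvectors of `H` at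
  `E(M)` in the sector form a one-dimensional space, and a nonzero one has, after multiplication by a
  nonzero constant, all coefficients `(-1)^{Σ_{x∈A} σ_x} ψ(σ)` real and strictly positive on the
  sector (Marshall sign rule) — the abstract theorem `perronFrobenius_groundState_*` of
  `PerronFrobeniusGroundState.lean` applied to the Marshall-conjugated compression of `H`;
  consequently the sector ground state is an eigenvector of `(𝐒_tot)²` (`sector_groundState_totalSpinSq`);
* **ladder operators on sectors** (second part): `Ŝ^±_tot` map the sector of weight `W ± 1` to the
  sector of weight `W` resp. `W + 1` and carry eigenvectors of `H` and of `(𝐒_tot)²` along; on the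
  sector of magnetisation `M`, `(𝐒_tot)² = Ŝ⁻Ŝ⁺ + M(M+1) = Ŝ⁺Ŝ⁻ + M(M-1)`, so an eigenvalue `λ` of
  `(𝐒_tot)²` on a sector vector is real with `λ ≥ M(M+1)`, `λ ≥ M(M-1)`,
  `‖Ŝ⁻v‖² = ‖Ŝ⁺v‖² + 2M ‖v‖²` (`Ŝ⁻v ≠ 0` for `M > 0`, `Ŝ⁺v ≠ 0` for `M < 0`), and `Ŝ⁺v = 0`
  (resp. `Ŝ⁻v = 0`) forces `(𝐒_tot)² v = M(M+1) v` (resp. `M(M-1) v`); sector components of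
  eigenvectors of `H` are eigenvectors; the sector energy is at most the eigenvalue of any
  eigenvector in the sector and at least the ground energy.

## Sources

E. Lieb, D. Mattis, J. Math. Phys. 3 (1962) 749, proof of Thm 2; W. Marshall, Proc. Roy. Soc.
A 232 (1955) 48; H. Tasaki, *Physics and Mathematics of Quantum Many-Body Systems* (2020), §2.4,
Thm 2.3 and its proof (Marshall–Lieb–Mattis theorem), App. A.3 (eqs. (A.3.6)–(A.3.10));
D. C. Mattis, *The Theory of Magnetism Made Simple* (2006), §5.10 ("the eigenstate of lowest
energy in each subspace is, unambiguously, nodeless"); A. Messiah, *Quantum Mechanics* II,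
ch. XIII §§4–6. All statements are finite-dimensional linear algebra. [folklore]
-/

noncomputable section

open Matrix Complex Finset

namespace Literature.MathematicalPhysics.QuantumLattice

namespace LiebMattis

section QLattice

variable {Λ : Type*} [Fintype Λ] [DecidableEq Λ] (n : ℕ)

/-! ### Hops and ergodicity of the configuration graph -/

omit [Fintype Λ] in
/-- A hop is possible whenever the source site is occupied and the target site has room: given
`σ` with `σ_x + 1 ≤ n` and `1 ≤ σ_y` there is `τ` with `τ_x = σ_x + 1`, `σ_y = τ_y + 1` and
`σ = τ` elsewhere. [folklore] -/
theorem exists_hop {x y : Λ} (hxy : x ≠ y) (σ : TensorIndex Λ (n + 1)) (hx : (σ x).val + 1 ≤ n)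
    (hy : 1 ≤ (σ y).val) :
    ∃ τ : TensorIndex Λ (n + 1), (τ x).val = (σ x).val + 1 ∧ (σ y).val = (τ y).val + 1 ∧
      ∀ z, z ≠ x → z ≠ y → σ z = τ z := by
  have hyb := (σ y).isLt
  refine ⟨Function.update (Function.update σ x ⟨(σ x).val + 1, by omega⟩) y
    ⟨(σ y).val - 1, by omega⟩, ?_, ?_, ?_⟩
  · rw [Function.update_of_ne hxy, Function.update_self]
  · rw [Function.update_self]
    change (σ y).val = ((σ y).val - 1) + 1
    omega
  · intro z hzx hzy
    rw [Function.update_of_ne hzy, Function.update_of_ne hzx]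

variable (G : SimpleGraph Λ) [DecidableRel G.Adj] (J : ℝ)

/-- A hop along an edge is a nonzero matrix element of `H` (`J > 0`). Lieb–Mattis (1962), proof
of Thm 2; Tasaki (2020) §2.4, proof of Thm 2.3. [folklore] -/
theorem heisenbergHamiltonian_apply_ne_zero_of_hop (hJ : 0 < J) {x y : Λ} (hadj : G.Adj x y)
    {σ τ : TensorIndex Λ (n + 1)} (hx : (τ x).val = (σ x).val + 1)
    (hy : (σ y).val = (τ y).val + 1) (hrest : ∀ z, z ≠ x → z ≠ y → σ z = τ z) :
    heisenbergHamiltonian n G J σ τ ≠ 0 := fun h => by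
  have := re_heisenbergHamiltonian_apply_pos_of_hop n G J hJ hadj hx hy hrest
  rw [h, Complex.zero_re] at this
  exact lt_irrefl _ this

/-- **Moving one unit along a walk.** If `y` and `x ≠ y` are joined by a walk of `G`, then from
any configuration with `1 ≤ σ_y`, `σ_x + 1 ≤ n`, the configuration with one unit moved from `y`
to `x` is reached by a chain of nonzero matrix elements of `H` (induction along the walk; if the
next site is full, first move one of its units onward to `x`, then refill it from `y`).
Lieb–Mattis (1962), proof of Thm 2; Tasaki (2020) §2.4, proof of Thm 2.3. [folklore] -/
theorem reflTransGen_of_walk (hJ : 0 < J) {y x : Λ} (w : G.Walk y x) :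
    y ≠ x → ∀ σ τ : TensorIndex Λ (n + 1), (τ x).val = (σ x).val + 1 →
      (σ y).val = (τ y).val + 1 → (∀ z, z ≠ x → z ≠ y → σ z = τ z) →
      Relation.ReflTransGen (fun a b => heisenbergHamiltonian n G J a b ≠ 0) σ τ := by
  induction w with
  | nil => exact fun h => absurd rfl h
  | @cons u v xx hadj w' ih =>
    intro hux σ τ hx hu hrest
    have huv : u ≠ v := hadj.ne
    by_cases hvx : v = xx
    · subst hvx
      exact Relation.ReflTransGen.single
        (heisenbergHamiltonian_apply_ne_zero_of_hop n G J hJ hadj.symm hx hu hrest)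
    · have hτx := (τ xx).isLt
      have hσv : σ v = τ v := hrest v hvx (Ne.symm huv)
      by_cases hroom : (σ v).val + 1 ≤ n
      · -- move `u → v` first, then `v → xx` by induction
        obtain ⟨σ', h1, h2, h3⟩ := exists_hop n (Ne.symm huv) σ hroom (by omega)
        refine Relation.ReflTransGen.head
          (heisenbergHamiltonian_apply_ne_zero_of_hop n G J hJ hadj.symm h1 h2 h3) ?_
        refine ih hvx σ' τ ?_ ?_ ?_
        · rw [← h3 xx (Ne.symm hvx) (Ne.symm hux)]
          exact hx
        · rw [h1, hσv]
        · intro z hzx hzv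
          by_cases hzu : z = u
          · subst hzu
            exact Fin.ext (by omega)
          · rw [← h3 z hzv hzu]
            exact hrest z hzx hzu
      · -- `v` is full: first move `v → xx` by induction, then hop `u → v`
        have hn : 1 ≤ (σ v).val := by omega
        obtain ⟨σ'', h1, h2, h3⟩ := exists_hop n (Ne.symm hvx) σ (by omega) hn
        refine (ih hvx σ σ'' h1 h2 h3).tail
          (heisenbergHamiltonian_apply_ne_zero_of_hop n G J hJ hadj.symm ?_ ?_ ?_)
        · have := congrArg Fin.val hσv
          omega
        · rw [← h3 u hux huv]
          exact hu
        · intro z hzv hzu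
          by_cases hzx : z = xx
          · subst hzx
            exact Fin.ext (by omega)
          · rw [← h3 z hzx hzv]
            exact hrest z hzx hzu

/-- **Moving one unit between any two sites of a connected graph** is a chain of nonzero matrix
elements of `H`. Lieb–Mattis (1962), proof of Thm 2. [folklore] -/
theorem reflTransGen_of_hop (hG : G.Connected) (hJ : 0 < J) {x y : Λ} (hxy : x ≠ y)
    {σ τ : TensorIndex Λ (n + 1)} (hx : (τ x).val = (σ x).val + 1)
    (hy : (σ y).val = (τ y).val + 1) (hrest : ∀ z, z ≠ x → z ≠ y → σ z = τ z) :
    Relation.ReflTransGen (fun a b => heisenbergHamiltonian n G J a b ≠ 0) σ τ := by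
  obtain ⟨w⟩ := hG.preconnected y x
  exact reflTransGen_of_walk n G J hJ w (Ne.symm hxy) σ τ hx hy hrest

omit [DecidableEq Λ] in
/-- Two configurations of equal weight which are pointwise comparable are equal. [folklore] -/
theorem eq_of_weight_eq_of_le {σ τ : TensorIndex Λ (n + 1)}
    (hw : (∑ z, (σ z : ℕ)) = ∑ z, (τ z : ℕ)) (hle : ∀ z, (σ z).val ≤ (τ z).val) : σ = τ := by
  have h := (Finset.sum_eq_sum_iff_of_le (s := (univ : Finset Λ)) fun z _ => hle z).1 hw
  exact funext fun z => Fin.ext (h z (mem_univ z))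

/-- **Ergodicity in a sector**: any two configurations of the same weight are joined by a chain
of nonzero matrix elements of `H` (connected graph, `J > 0`). Induction on the excess
`Σ_z (σ_z - τ_z)⁺`: move one unit from a site where `σ` exceeds `τ` to one where it falls short.
Lieb–Mattis (1962), proof of Thm 2 ("it is possible to go from any state to any other");
Tasaki (2020) §2.4, proof of Thm 2.3. [folklore] -/
theorem reflTransGen_of_weight_eq (hG : G.Connected) (hJ : 0 < J) :
    ∀ (k : ℕ) (σ τ : TensorIndex Λ (n + 1)), (∑ z, ((σ z).val - (τ z).val)) = k →
      (∑ z, (σ z : ℕ)) = (∑ z, (τ z : ℕ)) →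
      Relation.ReflTransGen (fun a b => heisenbergHamiltonian n G J a b ≠ 0) σ τ := by
  intro k
  induction k with
  | zero =>
    intro σ τ hk hw
    have hle : ∀ z, (σ z).val ≤ (τ z).val := by
      intro z
      have := (Finset.sum_eq_zero_iff.1 hk) z (mem_univ z)
      omega
    rw [eq_of_weight_eq_of_le n hw hle]
  | succ k ih =>
    intro σ τ hk hw
    -- a site where `σ` exceeds `τ`
    obtain ⟨y, hy⟩ : ∃ y, (τ y).val < (σ y).val := by
      by_contra h
      push Not at h
      have : (∑ z, ((σ z).val - (τ z).val)) = 0 :=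
        Finset.sum_eq_zero fun z _ => by have := h z; omega
      omega
    -- a site where `σ` falls short of `τ`
    obtain ⟨x, hx⟩ : ∃ x, (σ x).val < (τ x).val := by
      by_contra h
      push Not at h
      have := eq_of_weight_eq_of_le n hw.symm h
      rw [this] at hy
      exact lt_irrefl _ hy
    have hxy : x ≠ y := by
      rintro rfl
      omega
    have hτx := (τ x).isLt
    obtain ⟨σ', h1, h2, h3⟩ := exists_hop n hxy σ (by omega) (by omega)
    refine Relation.ReflTransGen.trans (reflTransGen_of_hop n G J hG hJ hxy h1 h2 h3) (ih σ' τ ?_ ?_)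
    · -- the excess drops by one
      have key : ∀ z, ((σ' z).val - (τ z).val) + (if z = y then 1 else 0) =
          (σ z).val - (τ z).val := by
        intro z
        by_cases hzy : z = y
        · subst hzy
          rw [if_pos rfl]
          omega
        · rw [if_neg hzy, add_zero]
          by_cases hzx : z = x
          · subst hzx
            omega
          · rw [h3 z hzx hzy]
      have hsum := Finset.sum_congr rfl fun z (_ : z ∈ (univ : Finset Λ)) => key z
      rw [Finset.sum_add_distrib, Finset.sum_ite_eq' univ y, if_pos (mem_univ y), hk] at hsum
      omega
    · -- the weight is unchanged
      have key : ∀ z, (σ' z).val + (if z = y then 1 else 0) = (σ z).val + (if z = x then 1 else 0) := by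
        intro z
        by_cases hzy : z = y
        · subst hzy
          rw [if_pos rfl, if_neg (Ne.symm hxy)]
          omega
        · rw [if_neg hzy, add_zero]
          by_cases hzx : z = x
          · subst hzx
            rw [if_pos rfl]
            omega
          · rw [if_neg hzx, add_zero, h3 z hzx hzy]
      have hsum := Finset.sum_congr rfl fun z (_ : z ∈ (univ : Finset Λ)) => key z
      rw [Finset.sum_add_distrib, Finset.sum_add_distrib, Finset.sum_ite_eq' univ y,
        Finset.sum_ite_eq' univ x, if_pos (mem_univ y), if_pos (mem_univ x)] at hsum
      omega

/-- Ergodicity inside the sector as a subtype: the chain of nonzero matrix elements between two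
configurations of weight `W` stays in weight `W` (`H` preserves the weight), so it is a chain for
the compression of any matrix with the same zero pattern. Lieb–Mattis (1962), proof of Thm 2.
[folklore] -/
theorem reflTransGen_subtype (hG : G.Connected) (hJ : 0 < J) (W : ℕ)
    {B : Matrix {σ : TensorIndex Λ (n + 1) // (∑ z, (σ z : ℕ)) = W}
      {σ : TensorIndex Λ (n + 1) // (∑ z, (σ z : ℕ)) = W} ℂ}
    (hB : ∀ s t, heisenbergHamiltonian n G J s.1 t.1 ≠ 0 → B s t ≠ 0)
    (s t : {σ : TensorIndex Λ (n + 1) // (∑ z, (σ z : ℕ)) = W}) :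
    Relation.ReflTransGen (fun a b => B a b ≠ 0) s t := by
  have key : ∀ σ τ : TensorIndex Λ (n + 1),
      Relation.ReflTransGen (fun a b => heisenbergHamiltonian n G J a b ≠ 0) σ τ →
      ∀ hσ : (∑ z, (σ z : ℕ)) = W, ∃ hτ : (∑ z, (τ z : ℕ)) = W,
        Relation.ReflTransGen (fun a b => B a b ≠ 0) ⟨σ, hσ⟩ ⟨τ, hτ⟩ := by
    intro σ τ h
    induction h with
    | refl => exact fun hσ => ⟨hσ, Relation.ReflTransGen.refl⟩
    | @tail b c _ hbc ih =>
      intro hσ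
      obtain ⟨hb, hpath⟩ := ih hσ
      have hc : (∑ z, (c z : ℕ)) = W := by
        by_contra hc
        exact hbc (heisenbergHamiltonian_apply_eq_zero_of_weight_ne n G J (by rw [hb]; exact Ne.symm hc))
      exact ⟨hc, hpath.tail (hB ⟨b, hb⟩ ⟨c, hc⟩ hbc)⟩
  obtain ⟨_, h⟩ := key s.1 t.1 (reflTransGen_of_weight_eq n G J hG hJ _ s.1 t.1 rfl (by rw [s.2, t.2])) s.2
  exact h

/-! ### Perron–Frobenius in a magnetisation sector -/

/-- From the bound on unit vectors of a sector to the homogeneous bound `E ‖φ‖² ≤ Re ⟨φ, H φ⟩`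
(normalise `φ ≠ 0`). Tasaki (2020) §2.1. [folklore] -/
theorem mul_norm_le_of_unit_bound (H : Op Λ (n + 1)) (K : Submodule ℂ (TensorIndex Λ (n + 1) → ℂ))
    {E : ℝ} (hb : ∀ v ∈ K, star v ⬝ᵥ v = 1 → E ≤ (star v ⬝ᵥ H *ᵥ v).re) {φ : TensorIndex Λ (n + 1) → ℂ}
    (hφ : φ ∈ K) : E * (star φ ⬝ᵥ φ).re ≤ (star φ ⬝ᵥ H *ᵥ φ).re := by
  by_cases h0 : φ = 0
  · subst h0
    simp
  obtain ⟨c, hc0, hc1⟩ := exists_smul_unit h0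
  have h2 := hb _ (K.smul_mem c hφ) hc1
  have hcc : star c * c = ((‖c‖ ^ 2 : ℝ) : ℂ) := by
    rw [Complex.star_def, Complex.conj_mul']
    push_cast
    rfl
  rw [mulVec_smul, star_smul, smul_dotProduct, dotProduct_smul, smul_smul, hcc, smul_eq_mul,
    Complex.re_ofReal_mul] at h2
  rw [star_smul, smul_dotProduct, dotProduct_smul, smul_smul, hcc, smul_eq_mul] at hc1
  have h1 : ‖c‖ ^ 2 * (star φ ⬝ᵥ φ).re = 1 := by
    have := congrArg Complex.re hc1
    rwa [Complex.re_ofReal_mul, Complex.one_re] at this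
  have hpos : 0 < ‖c‖ ^ 2 := by positivity
  have key : ‖c‖ ^ 2 * (E * (star φ ⬝ᵥ φ).re) ≤ ‖c‖ ^ 2 * (star φ ⬝ᵥ H *ᵥ φ).re :=
    calc ‖c‖ ^ 2 * (E * (star φ ⬝ᵥ φ).re) = E * (‖c‖ ^ 2 * (star φ ⬝ᵥ φ).re) := by ring
      _ = E := by rw [h1, mul_one]
      _ ≤ ‖c‖ ^ 2 * (star φ ⬝ᵥ H *ᵥ φ).re := h2
  exact le_of_mul_le_mul_left key hpos

/-- **The Marshall–Lieb–Mattis sector theorem (Perron–Frobenius in a magnetisation sector).**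
For the spin-`n/2` Heisenberg antiferromagnet (`J > 0`) on a finite connected graph, bipartite with
parts `A`, `Aᶜ`, and a nonempty weight sector `W` (magnetisation `M = |Λ| n/2 - W`):
(1) the sector energy `E(M) = lowestEnergyInSector` is attained at an eigenvector of `H` in the
sector; (2) it bounds the Rayleigh quotient on the sector from below; (3) eigenvectors of `H` at
`E(M)` in the sector are unique up to scalars; (4) a nonzero one satisfies the **Marshall sign
rule**: for a nonzero constant `c`, `c (-1)^{Σ_{x∈A} σ_x} ψ(σ) > 0` for every `σ` of weight `W`.
Marshall, Proc. Roy. Soc. A 232 (1955) 48; Lieb–Mattis, J. Math. Phys. 3 (1962) 749, Thm 2 and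
its proof; Tasaki (2020) §2.4, Thm 2.3 (Marshall–Lieb–Mattis theorem); Mattis (2006) §5.10.
[folklore] -/
theorem sector_perronFrobenius (A : Finset Λ) (hG : G.Connected)
    (hA : G.IsBipartiteWith (A : Set Λ) (↑A)ᶜ) (hJ : 0 < J) (W : ℕ)
    (hW : ∃ σ : TensorIndex Λ (n + 1), (∑ z, (σ z : ℕ)) = W) :
    (∃ ψ ∈ spinZSector (Λ := Λ) n (((Fintype.card Λ * n : ℕ) : ℝ) / 2 - W), ψ ≠ 0 ∧
      heisenbergHamiltonian n G J *ᵥ ψ =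
        ((lowestEnergyInSector n (heisenbergHamiltonian n G J)
          (((Fintype.card Λ * n : ℕ) : ℝ) / 2 - W) : ℝ) : ℂ) • ψ) ∧
    (∀ φ ∈ spinZSector (Λ := Λ) n (((Fintype.card Λ * n : ℕ) : ℝ) / 2 - W), star φ ⬝ᵥ φ = 1 →
      lowestEnergyInSector n (heisenbergHamiltonian n G J)
        (((Fintype.card Λ * n : ℕ) : ℝ) / 2 - W) ≤
        (star φ ⬝ᵥ heisenbergHamiltonian n G J *ᵥ φ).re) ∧
    (∀ ψ φ : TensorIndex Λ (n + 1) → ℂ,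
      ψ ∈ spinZSector (Λ := Λ) n (((Fintype.card Λ * n : ℕ) : ℝ) / 2 - W) →
      φ ∈ spinZSector (Λ := Λ) n (((Fintype.card Λ * n : ℕ) : ℝ) / 2 - W) →
      heisenbergHamiltonian n G J *ᵥ ψ =
        ((lowestEnergyInSector n (heisenbergHamiltonian n G J)
          (((Fintype.card Λ * n : ℕ) : ℝ) / 2 - W) : ℝ) : ℂ) • ψ →
      heisenbergHamiltonian n G J *ᵥ φ =
        ((lowestEnergyInSector n (heisenbergHamiltonian n G J)
          (((Fintype.card Λ * n : ℕ) : ℝ) / 2 - W) : ℝ) : ℂ) • φ →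
      ψ ≠ 0 → ∃ c : ℂ, φ = c • ψ) ∧
    (∀ ψ : TensorIndex Λ (n + 1) → ℂ,
      ψ ∈ spinZSector (Λ := Λ) n (((Fintype.card Λ * n : ℕ) : ℝ) / 2 - W) →
      heisenbergHamiltonian n G J *ᵥ ψ =
        ((lowestEnergyInSector n (heisenbergHamiltonian n G J)
          (((Fintype.card Λ * n : ℕ) : ℝ) / 2 - W) : ℝ) : ℂ) • ψ →
      ψ ≠ 0 → ∃ c : ℂ, c ≠ 0 ∧ ∀ σ : TensorIndex Λ (n + 1), (∑ z, (σ z : ℕ)) = W →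
        0 < (c * marshallSign A σ * ψ σ).re ∧ (c * marshallSign A σ * ψ σ).im = 0) := by
  set M : ℝ := ((Fintype.card Λ * n : ℕ) : ℝ) / 2 - W with hMdef
  set K := spinZSector (Λ := Λ) n M with hKdef
  set E : ℝ := lowestEnergyInSector n (heisenbergHamiltonian n G J) M with hEdef
  have hH : (heisenbergHamiltonian n G J).IsHermitian := heisenbergHamiltonian_isHermitian n G J
  have hK : ∀ v, v ∈ K ↔ ∀ σ, ¬(∑ z, (σ z : ℕ)) = W → v σ = 0 :=
    fun v => mem_spinZSector_weight_iff n W v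
  have hinv : ∀ σ τ : TensorIndex Λ (n + 1), ¬(∑ z, (σ z : ℕ)) = W → (∑ z, (τ z : ℕ)) = W →
      heisenbergHamiltonian n G J σ τ = 0 := fun σ τ hσ hτ =>
    heisenbergHamiltonian_apply_eq_zero_of_weight_ne n G J (by rw [hτ]; exact hσ)
  -- (1), (2): spectral theory in the invariant coordinate sector
  obtain ⟨h1, h2⟩ := sector_groundState (heisenbergHamiltonian n G J) hH
    (fun σ => (∑ z, (σ z : ℕ)) = W) hW hinv K hK
  have hE : (heisenbergHamiltonian n G J).minEnergyOn K = E := rfl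
  rw [hE] at h1 h2
  -- the Marshall-conjugated compression of `heisenbergHamiltonian n G J` to the sector
  set ι := {σ : TensorIndex Λ (n + 1) // (∑ z, (σ z : ℕ)) = W}
  set B : Matrix ι ι ℂ :=
    Matrix.of fun s t => marshallSign A s.1 * heisenbergHamiltonian n G J s.1 t.1 * marshallSign A t.1
    with hBdef
  have hBapply : ∀ s t : ι,
      B s t = marshallSign A s.1 * heisenbergHamiltonian n G J s.1 t.1 * marshallSign A t.1 :=
    fun s t => rfl
  have hreal : ∀ s t : ι, star (B s t) = B s t := by
    intro s t
    rw [hBapply, star_mul', star_mul', star_marshallSign, star_marshallSign,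
      star_heisenbergHamiltonian_apply]
  have hsymm : ∀ s t : ι, B s t = B t s := by
    intro s t
    rw [hBapply, hBapply, heisenbergHamiltonian_apply_comm n G J s.1 t.1]
    ring
  have hoff : ∀ s t : ι, s ≠ t → (B s t).re ≤ 0 := by
    intro s t hst
    rw [hBapply]
    exact re_marshall_heisenbergHamiltonian_marshall_nonpos n G J A hA hJ.le
      (fun h => hst (Subtype.ext h))
  have hconn : ∀ s t : ι, Relation.ReflTransGen (fun a b => B a b ≠ 0) s t := by
    refine reflTransGen_subtype n G J hG hJ W fun s t hst => ?_
    rw [hBapply]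
    refine mul_ne_zero (mul_ne_zero ?_ hst) ?_
    · rcases marshallSign_eq_or A s.1 with h | h <;> rw [h] <;> norm_num
    · rcases marshallSign_eq_or A t.1 with h | h <;> rw [h] <;> norm_num
  -- extension by zero with Marshall signs, and restriction
  have hext_mem : ∀ v : ι → ℂ,
      (fun σ => if h : (∑ z, (σ z : ℕ)) = W then marshallSign A σ * v ⟨σ, h⟩ else 0) ∈ K := by
    intro v
    rw [hK]
    intro σ hσ
    rw [dif_neg hσ]
  have hdot : ∀ (v : ι → ℂ) (w : TensorIndex Λ (n + 1) → ℂ),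
      star (fun σ => if h : (∑ z, (σ z : ℕ)) = W then marshallSign A σ * v ⟨σ, h⟩ else 0) ⬝ᵥ w =
        star v ⬝ᵥ fun s => marshallSign A s.1 * w s.1 := by
    intro v w
    rw [dotProduct, dotProduct, sum_eq_sum_subtype_of_support (fun σ => (∑ z, (σ z : ℕ)) = W)]
    · refine Finset.sum_congr rfl fun s _ => ?_
      rw [Pi.star_apply, Pi.star_apply, dif_pos s.2, star_mul', star_marshallSign]
      ring
    · intro σ hσ
      rw [Pi.star_apply, dif_neg hσ, star_zero, zero_mul]
  have hHext : ∀ (v : ι → ℂ) (s : ι),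
      (heisenbergHamiltonian n G J *ᵥ
        fun σ => if h : (∑ z, (σ z : ℕ)) = W then marshallSign A σ * v ⟨σ, h⟩ else 0) s.1 =
        marshallSign A s.1 * (B *ᵥ v) s := by
    intro v s
    rw [mulVec, dotProduct, mulVec, dotProduct, Finset.mul_sum,
      sum_eq_sum_subtype_of_support (fun σ => (∑ z, (σ z : ℕ)) = W)]
    · refine Finset.sum_congr rfl fun t _ => ?_
      rw [dif_pos t.2, hBapply, Subtype.coe_eta]
      have hm := marshallSign_mul_self A s.1
      linear_combination -(heisenbergHamiltonian n G J s.1 t.1 * marshallSign A t.1 * v t) * hm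
    · intro τ hτ
      rw [dif_neg hτ, mul_zero]
  have hEB : ∀ v : ι → ℂ, E * (star v ⬝ᵥ v).re ≤ (star v ⬝ᵥ B *ᵥ v).re := by
    intro v
    set φ : TensorIndex Λ (n + 1) → ℂ :=
      fun σ => if h : (∑ z, (σ z : ℕ)) = W then marshallSign A σ * v ⟨σ, h⟩ else 0 with hφdef
    have hφφ : star φ ⬝ᵥ φ = star v ⬝ᵥ v := by
      rw [hφdef, hdot]
      congr 1
      funext s
      rw [dif_pos s.2, ← mul_assoc, marshallSign_mul_self, one_mul]
    have hφH : star φ ⬝ᵥ heisenbergHamiltonian n G J *ᵥ φ = star v ⬝ᵥ B *ᵥ v := by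
      rw [hφdef, hdot]
      congr 1
      funext s
      rw [hHext, ← mul_assoc, marshallSign_mul_self, one_mul]
    have := mul_norm_le_of_unit_bound n (heisenbergHamiltonian n G J) K h2 (hext_mem v)
    rw [hφφ, hφH] at this
    exact this
  -- restriction of sector eigenvectors
  have hres : ∀ ψ : TensorIndex Λ (n + 1) → ℂ, ψ ∈ K →
      heisenbergHamiltonian n G J *ᵥ ψ = (E : ℂ) • ψ →
      B *ᵥ (fun s : ι => marshallSign A s.1 * ψ s.1) =
        (E : ℂ) • fun s : ι => marshallSign A s.1 * ψ s.1 := by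
    intro ψ hψ hHψ
    funext s
    rw [Pi.smul_apply, smul_eq_mul, mulVec, dotProduct]
    have h := congrFun hHψ s.1
    rw [Pi.smul_apply, smul_eq_mul, mulVec, dotProduct,
      sum_eq_sum_subtype_of_support (fun σ => (∑ z, (σ z : ℕ)) = W)] at h
    · calc ∑ t : ι, B s t * (marshallSign A t.1 * ψ t.1)
          = marshallSign A s.1 * ∑ t : ι, heisenbergHamiltonian n G J s.1 t.1 * ψ t.1 := by
            rw [Finset.mul_sum]
            refine Finset.sum_congr rfl fun t _ => ?_
            rw [hBapply]
            have hm := marshallSign_mul_self A t.1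
            linear_combination (marshallSign A s.1 * heisenbergHamiltonian n G J s.1 t.1 * ψ t.1) * hm
        _ = (E : ℂ) * (marshallSign A s.1 * ψ s.1) := by rw [h]; ring
    · intro τ hτ
      rw [(hK ψ).1 hψ τ hτ, mul_zero]
  have hres0 : ∀ ψ : TensorIndex Λ (n + 1) → ℂ, ψ ∈ K → ψ ≠ 0 →
      (fun s : ι => marshallSign A s.1 * ψ s.1) ≠ 0 := by
    intro ψ hψ hψ0 h
    apply hψ0
    funext σ
    by_cases hσ : (∑ z, (σ z : ℕ)) = W
    · have h1 := congrFun h ⟨σ, hσ⟩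
      simp only [Pi.zero_apply, mul_eq_zero] at h1
      rcases h1 with h1 | h1
      · rcases marshallSign_eq_or A σ with h2 | h2 <;> rw [h2] at h1 <;> norm_num at h1
      · exact h1
    · exact (hK ψ).1 hψ σ hσ
  refine ⟨h1, h2, ?_, ?_⟩
  · -- (3) uniqueness
    intro ψ φ hψ hφ hHψ hHφ hψ0
    obtain ⟨c, hc⟩ := perronFrobenius_groundState_unique hsymm hreal hoff hconn hEB
      (hres ψ hψ hHψ) (hres φ hφ hHφ) (hres0 ψ hψ hψ0)
    refine ⟨c, funext fun σ => ?_⟩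
    by_cases hσ : (∑ z, (σ z : ℕ)) = W
    · have h := congrFun hc ⟨σ, hσ⟩
      simp only [Pi.smul_apply, smul_eq_mul] at h
      have hm := marshallSign_mul_self A σ
      rw [Pi.smul_apply, smul_eq_mul]
      linear_combination marshallSign A σ * h - (φ σ - c * ψ σ) * hm
    · rw [Pi.smul_apply, smul_eq_mul, (hK ψ).1 hψ σ hσ, (hK φ).1 hφ σ hσ, mul_zero]
  · -- (4) positivity (Marshall sign rule)
    intro ψ hψ hHψ hψ0
    obtain ⟨c, hc0, hc⟩ := perronFrobenius_groundState_smul_pos hsymm hreal hoff hconn hEB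
      (hres ψ hψ hHψ) (hres0 ψ hψ hψ0)
    refine ⟨c, hc0, fun σ hσ => ?_⟩
    have h := hc ⟨σ, hσ⟩
    rw [← mul_assoc] at h
    exact h

/-- **The sector ground state is an eigenvector of `(𝐒_tot)²`**: `(𝐒_tot)²` commutes with `H`
and with `Ŝᶻ_tot`, so it maps the (one-dimensional) space of sector ground states to itself.
Lieb–Mattis (1962), proof of Thm 2; Tasaki (2020) §2.4, proof of Thm 2.3. [folklore] -/
theorem sector_groundState_totalSpinSq (A : Finset Λ) (hG : G.Connected)
    (hA : G.IsBipartiteWith (A : Set Λ) (↑A)ᶜ) (hJ : 0 < J) (W : ℕ)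
    {ψ : TensorIndex Λ (n + 1) → ℂ}
    (hψ : ψ ∈ spinZSector (Λ := Λ) n (((Fintype.card Λ * n : ℕ) : ℝ) / 2 - W))
    (hHψ : heisenbergHamiltonian n G J *ᵥ ψ =
      ((lowestEnergyInSector n (heisenbergHamiltonian n G J)
        (((Fintype.card Λ * n : ℕ) : ℝ) / 2 - W) : ℝ) : ℂ) • ψ)
    (hψ0 : ψ ≠ 0) : ∃ lam : ℂ, totalSpinSq n *ᵥ ψ = lam • ψ := by
  have hW : ∃ σ : TensorIndex Λ (n + 1), (∑ z, (σ z : ℕ)) = W := by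
    by_contra h
    push Not at h
    exact hψ0 (funext fun σ => (mem_spinZSector_weight_iff n W ψ).1 hψ σ (h σ))
  obtain ⟨-, -, huniq, -⟩ := sector_perronFrobenius n G J A hG hA hJ W hW
  have hψ' := (mem_spinZSector_weight_iff n W ψ).1 hψ
  have hmem : totalSpinSq n *ᵥ ψ ∈ spinZSector (Λ := Λ) n (((Fintype.card Λ * n : ℕ) : ℝ) / 2 - W) := by
    rw [mem_spinZSector_weight_iff]
    exact mulVec_supported_of_commute_totalSpin_two n (commute_totalSpinSq_totalSpin n 2) hψ'
  have heig : heisenbergHamiltonian n G J *ᵥ (totalSpinSq n *ᵥ ψ) =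
      ((lowestEnergyInSector n (heisenbergHamiltonian n G J)
        (((Fintype.card Λ * n : ℕ) : ℝ) / 2 - W) : ℝ) : ℂ) • (totalSpinSq n *ᵥ ψ) := by
    rw [mulVec_mulVec, (commute_heisenbergHamiltonian_totalSpinSq n G J).eq, ← mulVec_mulVec, hHψ,
      mulVec_smul]
  exact huniq ψ _ hψ hmem hHψ heig hψ0

end QLattice

/-! ## Part 2: ladder operators on magnetisation sectors — spectral consequences -/

open EigenvalueContinuation

section QLattice

variable {Λ : Type*} [Fintype Λ] [DecidableEq Λ] (n : ℕ)

/-! ### `Ŝᶻ_tot` and `(𝐒_tot)²` on a sector -/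

/-- On the sector `𝓗_M`, `Ŝᶻ_tot` acts as the scalar `M`. Tasaki (2020) §2.4, eq. (2.4.5).
[folklore] -/
theorem totalSpin_two_mulVec_of_mem {M : ℝ} {v : TensorIndex Λ (n + 1) → ℂ}
    (hv : v ∈ spinZSector (Λ := Λ) n M) : totalSpin n 2 *ᵥ v = (M : ℂ) • v := by
  have h := Module.End.mem_eigenspace_iff.1 hv
  rwa [Matrix.toLin'_apply] at h

/-- **`(𝐒_tot)² v = Ŝ⁻Ŝ⁺ v + M(M+1) v` on the sector `𝓗_M`.** Tasaki (2020) App. A.3,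
eq. (A.3.8); Messiah XIII.(25). [folklore] -/
theorem totalSpinSq_mulVec_eq_lower_raise {M : ℝ} {v : TensorIndex Λ (n + 1) → ℂ}
    (hv : v ∈ spinZSector (Λ := Λ) n M) :
    totalSpinSq n *ᵥ v =
      (totalSpin n 0 - I • totalSpin n 1) *ᵥ ((totalSpin n 0 + I • totalSpin n 1) *ᵥ v) +
        ((M * M + M : ℝ) : ℂ) • v := by
  rw [totalSpinSq_eq_lower_mul_raise, add_mulVec, add_mulVec, ← mulVec_mulVec, ← mulVec_mulVec,
    totalSpin_two_mulVec_of_mem n hv, mulVec_smul, totalSpin_two_mulVec_of_mem n hv, smul_smul,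
    add_assoc, ← add_smul]
  push_cast
  rfl

/-- **`(𝐒_tot)² v = Ŝ⁺Ŝ⁻ v + M(M-1) v` on the sector `𝓗_M`.** Tasaki (2020) App. A.3,
eq. (A.3.8); Messiah XIII.(25). [folklore] -/
theorem totalSpinSq_mulVec_eq_raise_lower {M : ℝ} {v : TensorIndex Λ (n + 1) → ℂ}
    (hv : v ∈ spinZSector (Λ := Λ) n M) :
    totalSpinSq n *ᵥ v =
      (totalSpin n 0 + I • totalSpin n 1) *ᵥ ((totalSpin n 0 - I • totalSpin n 1) *ᵥ v) +
        ((M * M - M : ℝ) : ℂ) • v := by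
  rw [totalSpinSq_eq_raise_mul_lower, sub_mulVec, add_mulVec, ← mulVec_mulVec, ← mulVec_mulVec,
    totalSpin_two_mulVec_of_mem n hv, mulVec_smul, totalSpin_two_mulVec_of_mem n hv, smul_smul,
    add_sub_assoc, ← sub_smul]
  push_cast
  rfl

/-- A highest-weight vector of the sector `𝓗_M` (`Ŝ⁺v = 0`) has `(𝐒_tot)² v = M(M+1) v`.
Tasaki (2020) App. A.3, eq. (A.3.10). [folklore] -/
theorem totalSpinSq_mulVec_of_raise_eq_zero {M : ℝ} {v : TensorIndex Λ (n + 1) → ℂ}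
    (hv : v ∈ spinZSector (Λ := Λ) n M)
    (h : (totalSpin n 0 + I • totalSpin n 1 : Op Λ (n + 1)) *ᵥ v = 0) :
    totalSpinSq n *ᵥ v = ((M * M + M : ℝ) : ℂ) • v := by
  rw [totalSpinSq_mulVec_eq_lower_raise n hv, h, mulVec_zero, zero_add]

/-- A lowest-weight vector of the sector `𝓗_M` (`Ŝ⁻v = 0`) has `(𝐒_tot)² v = M(M-1) v`.
Tasaki (2020) App. A.3, eq. (A.3.10). [folklore] -/
theorem totalSpinSq_mulVec_of_lower_eq_zero {M : ℝ} {v : TensorIndex Λ (n + 1) → ℂ}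
    (hv : v ∈ spinZSector (Λ := Λ) n M)
    (h : (totalSpin n 0 - I • totalSpin n 1 : Op Λ (n + 1)) *ᵥ v = 0) :
    totalSpinSq n *ᵥ v = ((M * M - M : ℝ) : ℂ) • v := by
  rw [totalSpinSq_mulVec_eq_raise_lower n hv, h, mulVec_zero, zero_add]

/-- **`⟨v, (𝐒_tot)² v⟩ = ‖Ŝ⁺v‖² + M(M+1) ‖v‖²` on the sector `𝓗_M`.** Tasaki (2020) App. A.3.
[folklore] -/
theorem star_dotProduct_totalSpinSq_mulVec_raise {M : ℝ} {v : TensorIndex Λ (n + 1) → ℂ}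
    (hv : v ∈ spinZSector (Λ := Λ) n M) :
    star v ⬝ᵥ (totalSpinSq n *ᵥ v) =
      star ((totalSpin n 0 + I • totalSpin n 1 : Op Λ (n + 1)) *ᵥ v) ⬝ᵥ
          ((totalSpin n 0 + I • totalSpin n 1 : Op Λ (n + 1)) *ᵥ v) +
        ((M * M + M : ℝ) : ℂ) * (star v ⬝ᵥ v) := by
  rw [totalSpinSq_mulVec_eq_lower_raise n hv, dotProduct_add, dotProduct_smul, smul_eq_mul,
    dotProduct_mulVec, star_mulVec, conjTranspose_totalSpin_raise]

/-- **`⟨v, (𝐒_tot)² v⟩ = ‖Ŝ⁻v‖² + M(M-1) ‖v‖²` on the sector `𝓗_M`.** Tasaki (2020) App. A.3.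
[folklore] -/
theorem star_dotProduct_totalSpinSq_mulVec_lower {M : ℝ} {v : TensorIndex Λ (n + 1) → ℂ}
    (hv : v ∈ spinZSector (Λ := Λ) n M) :
    star v ⬝ᵥ (totalSpinSq n *ᵥ v) =
      star ((totalSpin n 0 - I • totalSpin n 1 : Op Λ (n + 1)) *ᵥ v) ⬝ᵥ
          ((totalSpin n 0 - I • totalSpin n 1 : Op Λ (n + 1)) *ᵥ v) +
        ((M * M - M : ℝ) : ℂ) * (star v ⬝ᵥ v) := by
  rw [totalSpinSq_mulVec_eq_raise_lower n hv, dotProduct_add, dotProduct_smul, smul_eq_mul,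
    dotProduct_mulVec, star_mulVec, conjTranspose_totalSpin_lower]

/-- **`‖Ŝ⁻v‖² = ‖Ŝ⁺v‖² + 2M ‖v‖²` on the sector `𝓗_M`** (from `[Ŝ⁺, Ŝ⁻] = 2Ŝᶻ`).
Tasaki (2020) App. A.3, eq. (A.3.6). [folklore] -/
theorem re_norm_lower_eq {M : ℝ} {v : TensorIndex Λ (n + 1) → ℂ}
    (hv : v ∈ spinZSector (Λ := Λ) n M) :
    (star ((totalSpin n 0 - I • totalSpin n 1 : Op Λ (n + 1)) *ᵥ v) ⬝ᵥ
        ((totalSpin n 0 - I • totalSpin n 1 : Op Λ (n + 1)) *ᵥ v)).re =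
      (star ((totalSpin n 0 + I • totalSpin n 1 : Op Λ (n + 1)) *ᵥ v) ⬝ᵥ
          ((totalSpin n 0 + I • totalSpin n 1 : Op Λ (n + 1)) *ᵥ v)).re +
        2 * M * (star v ⬝ᵥ v).re := by
  have h1 := star_dotProduct_totalSpinSq_mulVec_raise n hv
  have h2 := star_dotProduct_totalSpinSq_mulVec_lower n hv
  rw [h1] at h2
  have h3 := congrArg Complex.re h2
  simp only [Complex.add_re, Complex.re_ofReal_mul] at h3
  linarith

/-- **On a sector of positive magnetisation no nonzero vector is lowest weight**: `Ŝ⁻v ≠ 0` for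
`v ≠ 0` in `𝓗_M`, `M > 0`. Tasaki (2020) App. A.3. [folklore] -/
theorem lower_mulVec_ne_zero_of_pos {M : ℝ} (hM : 0 < M) {v : TensorIndex Λ (n + 1) → ℂ}
    (hv : v ∈ spinZSector (Λ := Λ) n M) (hv0 : v ≠ 0) :
    (totalSpin n 0 - I • totalSpin n 1 : Op Λ (n + 1)) *ᵥ v ≠ 0 := by
  intro h
  have h1 := re_norm_lower_eq n hv
  rw [h, dotProduct_zero, Complex.zero_re] at h1
  have h2 := re_star_dotProduct_self_nonneg ((totalSpin n 0 + I • totalSpin n 1 : Op Λ (n + 1)) *ᵥ v)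
  have h3 := re_star_dotProduct_self_pos hv0
  nlinarith

/-- **On a sector of negative magnetisation no nonzero vector is highest weight**: `Ŝ⁺v ≠ 0` for
`v ≠ 0` in `𝓗_M`, `M < 0`. Tasaki (2020) App. A.3. [folklore] -/
theorem raise_mulVec_ne_zero_of_neg {M : ℝ} (hM : M < 0) {v : TensorIndex Λ (n + 1) → ℂ}
    (hv : v ∈ spinZSector (Λ := Λ) n M) (hv0 : v ≠ 0) :
    (totalSpin n 0 + I • totalSpin n 1 : Op Λ (n + 1)) *ᵥ v ≠ 0 := by
  intro h
  have h1 := re_norm_lower_eq n hv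
  rw [h, dotProduct_zero, Complex.zero_re] at h1
  have h2 := re_star_dotProduct_self_nonneg ((totalSpin n 0 - I • totalSpin n 1 : Op Λ (n + 1)) *ᵥ v)
  have h3 := re_star_dotProduct_self_pos hv0
  nlinarith

/-- **Eigenvalues of `(𝐒_tot)²` on the sector `𝓗_M` are real and at least `M(M+1)`.**
Tasaki (2020) App. A.3, eq. (A.3.9). [folklore] -/
theorem eigenvalue_totalSpinSq_ge_raise {M : ℝ} {v : TensorIndex Λ (n + 1) → ℂ}
    (hv : v ∈ spinZSector (Λ := Λ) n M) (hv0 : v ≠ 0) {lam : ℂ}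
    (hS : totalSpinSq n *ᵥ v = lam • v) : M * M + M ≤ lam.re ∧ lam.im = 0 := by
  have h := star_dotProduct_totalSpinSq_mulVec_raise n hv
  rw [hS, dotProduct_smul, smul_eq_mul] at h
  have hq0 := re_star_dotProduct_self_pos hv0
  have hqi := im_star_dotProduct_self v
  have hp0 := re_star_dotProduct_self_nonneg ((totalSpin n 0 + I • totalSpin n 1 : Op Λ (n + 1)) *ᵥ v)
  have hpi := im_star_dotProduct_self ((totalSpin n 0 + I • totalSpin n 1 : Op Λ (n + 1)) *ᵥ v)
  have hre := congrArg Complex.re h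
  have him := congrArg Complex.im h
  simp only [Complex.mul_re, Complex.mul_im, Complex.add_re, Complex.add_im, Complex.ofReal_re,
    Complex.ofReal_im, hqi, hpi, mul_zero, sub_zero, zero_mul, add_zero] at hre him
  refine ⟨?_, ?_⟩
  · nlinarith
  · rw [zero_add] at him
    rcases mul_eq_zero.1 him with h1 | h1
    · exact h1
    · exact absurd h1 hq0.ne'

/-- **Eigenvalues of `(𝐒_tot)²` on the sector `𝓗_M` are at least `M(M-1)`.**
Tasaki (2020) App. A.3, eq. (A.3.9). [folklore] -/
theorem eigenvalue_totalSpinSq_ge_lower {M : ℝ} {v : TensorIndex Λ (n + 1) → ℂ}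
    (hv : v ∈ spinZSector (Λ := Λ) n M) (hv0 : v ≠ 0) {lam : ℂ}
    (hS : totalSpinSq n *ᵥ v = lam • v) : M * M - M ≤ lam.re := by
  have h := star_dotProduct_totalSpinSq_mulVec_lower n hv
  rw [hS, dotProduct_smul, smul_eq_mul] at h
  have hq0 := re_star_dotProduct_self_pos hv0
  have hqi := im_star_dotProduct_self v
  have hp0 := re_star_dotProduct_self_nonneg ((totalSpin n 0 - I • totalSpin n 1 : Op Λ (n + 1)) *ᵥ v)
  have hre := congrArg Complex.re h
  simp only [Complex.mul_re, Complex.add_re, Complex.ofReal_re, Complex.ofReal_im, hqi, mul_zero,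
    sub_zero] at hre
  nlinarith

/-! ### Raising and lowering eigenvectors -/

/-- `Ŝ⁺_tot` maps the sector of weight `W + 1` into the sector of weight `W`.
Tasaki (2020) App. A.3. [folklore] -/
theorem raise_mulVec_mem {W : ℕ} {ψ : TensorIndex Λ (n + 1) → ℂ}
    (hψ : ψ ∈ spinZSector (Λ := Λ) n (((Fintype.card Λ * n : ℕ) : ℝ) / 2 - (W + 1 : ℕ))) :
    (totalSpin n 0 + I • totalSpin n 1 : Op Λ (n + 1)) *ᵥ ψ ∈
      spinZSector (Λ := Λ) n (((Fintype.card Λ * n : ℕ) : ℝ) / 2 - W) := by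
  rw [mem_spinZSector_weight_iff] at hψ ⊢
  exact raise_mulVec_supported n hψ

/-- `Ŝ⁻_tot` maps the sector of weight `W` into the sector of weight `W + 1`.
Tasaki (2020) App. A.3. [folklore] -/
theorem lower_mulVec_mem {W : ℕ} {ψ : TensorIndex Λ (n + 1) → ℂ}
    (hψ : ψ ∈ spinZSector (Λ := Λ) n (((Fintype.card Λ * n : ℕ) : ℝ) / 2 - W)) :
    (totalSpin n 0 - I • totalSpin n 1 : Op Λ (n + 1)) *ᵥ ψ ∈
      spinZSector (Λ := Λ) n (((Fintype.card Λ * n : ℕ) : ℝ) / 2 - (W + 1 : ℕ)) := by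
  rw [mem_spinZSector_weight_iff] at hψ ⊢
  exact lower_mulVec_supported n hψ

/-- `Ŝ⁺_tot` annihilates the sector of weight `0` (all spins up). Tasaki (2020) App. A.3.
[folklore] -/
theorem raise_mulVec_eq_zero_of_weight_zero {ψ : TensorIndex Λ (n + 1) → ℂ}
    (hψ : ψ ∈ spinZSector (Λ := Λ) n (((Fintype.card Λ * n : ℕ) : ℝ) / 2 - (0 : ℕ))) :
    (totalSpin n 0 + I • totalSpin n 1 : Op Λ (n + 1)) *ᵥ ψ = 0 := by
  rw [mem_spinZSector_weight_iff] at hψ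
  funext σ
  rw [Pi.zero_apply, mulVec, dotProduct]
  refine Finset.sum_eq_zero fun τ _ => ?_
  by_cases h : (totalSpin n 0 + I • totalSpin n 1 : Op Λ (n + 1)) σ τ = 0
  · rw [h, zero_mul]
  · have := weight_eq_of_raise_apply_ne_zero n h
    rw [hψ τ (by omega), mul_zero]

/-- An operator commuting with `H` maps eigenvectors of `H` to eigenvectors (or zero) with the
same eigenvalue. [folklore] -/
theorem mulVec_eigenvector_of_commute {H S : Op Λ (n + 1)} (hc : Commute H S)
    {ψ : TensorIndex Λ (n + 1) → ℂ} {E : ℂ} (h : H *ᵥ ψ = E • ψ) :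
    H *ᵥ (S *ᵥ ψ) = E • (S *ᵥ ψ) := by
  rw [mulVec_mulVec, hc.eq, ← mulVec_mulVec, h, mulVec_smul]

/-- If two eigenvectors of an operator are proportional with a nonzero factor and the second is
nonzero, their eigenvalues agree. [folklore] -/
theorem eigenvalue_eq_of_eq_smul {S : Op Λ (n + 1)} {φ ψ : TensorIndex Λ (n + 1) → ℂ}
    {a b c : ℂ} (hφ : S *ᵥ φ = a • φ) (hψ : S *ᵥ ψ = b • ψ) (h : φ = c • ψ) (hc : c ≠ 0)
    (hψ0 : ψ ≠ 0) : a = b := by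
  obtain ⟨σ, hσ⟩ := Function.ne_iff.1 hψ0
  rw [h, mulVec_smul, hψ, smul_smul, smul_smul] at hφ
  have h1 := congrFun hφ σ
  simp only [Pi.smul_apply, smul_eq_mul] at h1
  have h2 : (a - b) * (c * ψ σ) = 0 := by linear_combination -h1
  rcases mul_eq_zero.1 h2 with h3 | h3
  · exact sub_eq_zero.1 h3
  · exact absurd h3 (mul_ne_zero hc hσ)

/-! ### Sector components of eigenvectors -/

section Graph

variable (G : SimpleGraph Λ) [DecidableRel G.Adj] (J : ℝ)

/-- The weight-`W` component `σ ↦ [W(σ) = W] Φ(σ)` of a vector lies in the sector of weight `W`.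
Tasaki (2020) §2.4, eq. (2.4.5). [folklore] -/
theorem component_mem (Φ : TensorIndex Λ (n + 1) → ℂ) (W : ℕ) :
    (fun σ => if (∑ z, (σ z : ℕ)) = W then Φ σ else 0) ∈
      spinZSector (Λ := Λ) n (((Fintype.card Λ * n : ℕ) : ℝ) / 2 - W) := by
  rw [mem_spinZSector_weight_iff]
  intro σ hσ
  rw [if_neg hσ]

/-- **`H` is block diagonal**: the weight components of an eigenvector of `H` are eigenvectors
(or zero) with the same eigenvalue. Tasaki (2020) §2.4, eq. (2.4.5). [folklore] -/
theorem heisenbergHamiltonian_mulVec_component {Φ : TensorIndex Λ (n + 1) → ℂ} {μ : ℂ}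
    (h : heisenbergHamiltonian n G J *ᵥ Φ = μ • Φ) (W : ℕ) :
    heisenbergHamiltonian n G J *ᵥ (fun σ => if (∑ z, (σ z : ℕ)) = W then Φ σ else 0) =
      μ • fun σ => if (∑ z, (σ z : ℕ)) = W then Φ σ else 0 := by
  funext σ
  rw [Pi.smul_apply, smul_eq_mul]
  by_cases hσ : (∑ z, (σ z : ℕ)) = W
  · rw [if_pos hσ]
    have h1 := congrFun h σ
    rw [Pi.smul_apply, smul_eq_mul] at h1
    rw [← h1, mulVec, mulVec, dotProduct, dotProduct]
    refine Finset.sum_congr rfl fun τ _ => ?_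
    by_cases hτ : (∑ z, (τ z : ℕ)) = W
    · rw [if_pos hτ]
    · rw [if_neg hτ, heisenbergHamiltonian_apply_eq_zero_of_weight_ne n G J (by rw [hσ]; exact Ne.symm hτ),
        zero_mul, zero_mul]
  · rw [if_neg hσ, mul_zero]
    exact mulVec_supported_of_commute_totalSpin_two n (commute_heisenbergHamiltonian_totalSpin n G J 2)
      (W := W) (fun τ hτ => if_neg hτ) σ hσ

omit [DecidableEq Λ] in
/-- Every configuration has weight at most `|Λ| n`. [folklore] -/
theorem weight_le (σ : TensorIndex Λ (n + 1)) : (∑ z, (σ z : ℕ)) ≤ Fintype.card Λ * n := by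
  calc (∑ z, (σ z : ℕ)) ≤ ∑ _z : Λ, n := Finset.sum_le_sum fun z _ => Nat.lt_succ_iff.1 (σ z).isLt
    _ = Fintype.card Λ * n := by rw [Finset.sum_const, Finset.card_univ, smul_eq_mul]

omit [DecidableEq Λ] in
/-- **A vector is the sum of its weight components**, `Φ = Σ_{W ≤ |Λ| n} Φ_W`.
Tasaki (2020) §2.4, eq. (2.4.5). [folklore] -/
theorem sum_components (Φ : TensorIndex Λ (n + 1) → ℂ) :
    (∑ W ∈ Finset.range (Fintype.card Λ * n + 1),
      fun σ => if (∑ z, (σ z : ℕ)) = W then Φ σ else 0) = Φ := by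
  funext σ
  rw [Finset.sum_apply, Finset.sum_ite_eq, if_pos]
  exact Finset.mem_range.2 (Nat.lt_succ_of_le (weight_le n σ))

/-! ### Sector energies versus eigenvalues and the ground energy -/

/-- **Ground states exist in every nonempty weight sector** of the Heisenberg Hamiltonian, and
the sector energy bounds the Rayleigh quotient on the sector from below (`H` is Hermitian and
block diagonal; `sector_groundState` of `SectorSpectrum.lean`). Tasaki (2020) §2.2, §2.4.
[folklore] -/
theorem sector_groundState_weight (W : ℕ) (hW : ∃ σ : TensorIndex Λ (n + 1), (∑ z, (σ z : ℕ)) = W) :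
    (∃ ψ ∈ spinZSector (Λ := Λ) n (((Fintype.card Λ * n : ℕ) : ℝ) / 2 - W), ψ ≠ 0 ∧
      heisenbergHamiltonian n G J *ᵥ ψ =
        ((lowestEnergyInSector n (heisenbergHamiltonian n G J)
          (((Fintype.card Λ * n : ℕ) : ℝ) / 2 - W) : ℝ) : ℂ) • ψ) ∧
    (∀ φ ∈ spinZSector (Λ := Λ) n (((Fintype.card Λ * n : ℕ) : ℝ) / 2 - W), star φ ⬝ᵥ φ = 1 →
      lowestEnergyInSector n (heisenbergHamiltonian n G J)
        (((Fintype.card Λ * n : ℕ) : ℝ) / 2 - W) ≤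
        (star φ ⬝ᵥ heisenbergHamiltonian n G J *ᵥ φ).re) :=
  sector_groundState (heisenbergHamiltonian n G J) (heisenbergHamiltonian_isHermitian n G J)
    (fun σ => (∑ z, (σ z : ℕ)) = W) hW
    (fun _ _ hσ hτ => heisenbergHamiltonian_apply_eq_zero_of_weight_ne n G J (by rw [hτ]; exact hσ))
    _ (fun v => mem_spinZSector_weight_iff n W v)

/-- **The sector energy is at most the eigenvalue of any eigenvector of `H` in the sector.**
Tasaki (2020) §2.4, proof of Thm 2.3. [folklore] -/
theorem lowestEnergyInSector_le_of_eigenvector (W : ℕ) {φ : TensorIndex Λ (n + 1) → ℂ}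
    (hφ : φ ∈ spinZSector (Λ := Λ) n (((Fintype.card Λ * n : ℕ) : ℝ) / 2 - W)) (hφ0 : φ ≠ 0)
    {E : ℝ} (hHφ : heisenbergHamiltonian n G J *ᵥ φ = (E : ℂ) • φ) :
    lowestEnergyInSector n (heisenbergHamiltonian n G J)
      (((Fintype.card Λ * n : ℕ) : ℝ) / 2 - W) ≤ E := by
  have hW : ∃ σ : TensorIndex Λ (n + 1), (∑ z, (σ z : ℕ)) = W := by
    by_contra h
    push Not at h
    exact hφ0 (funext fun σ => (mem_spinZSector_weight_iff n W φ).1 hφ σ (h σ))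
  obtain ⟨-, hb⟩ := sector_groundState_weight n G J W hW
  have h := mul_norm_le_of_unit_bound n (heisenbergHamiltonian n G J) _ hb hφ
  rw [hHφ, dotProduct_smul, smul_eq_mul, Complex.re_ofReal_mul] at h
  exact le_of_mul_le_mul_right h (re_star_dotProduct_self_pos hφ0)

/-- **The ground energy is at most every sector energy** (variational principle).
Tasaki (2020) §2.1, §2.4. [folklore] -/
theorem groundEnergy_le_lowestEnergyInSector (W : ℕ)
    (hW : ∃ σ : TensorIndex Λ (n + 1), (∑ z, (σ z : ℕ)) = W) :
    (heisenbergHamiltonian n G J).groundEnergy ≤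
      lowestEnergyInSector n (heisenbergHamiltonian n G J)
        (((Fintype.card Λ * n : ℕ) : ℝ) / 2 - W) := by
  obtain ⟨⟨ψ, -, hψ0, hHψ⟩, -⟩ := sector_groundState_weight n G J W hW
  obtain ⟨c, -, hc1⟩ := exists_smul_unit hψ0
  have h := Matrix.groundEnergy_le_rayleigh_holds (heisenbergHamiltonian_isHermitian n G J) _ hc1
  rw [mulVec_smul, hHψ, smul_comm, dotProduct_smul, hc1, smul_eq_mul, mul_one,
    Complex.ofReal_re] at h
  exact h

/-- **An eigenvalue of `H` with an eigenvector in a sector which equals the ground energy is the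
sector energy**: if `H φ = E₀ φ`, `φ ≠ 0` in the sector, then `E(sector) = E₀`. Tasaki (2020)
§2.4, proof of Thm 2.3. [folklore] -/
theorem lowestEnergyInSector_eq_groundEnergy_of_eigenvector (W : ℕ)
    {φ : TensorIndex Λ (n + 1) → ℂ}
    (hφ : φ ∈ spinZSector (Λ := Λ) n (((Fintype.card Λ * n : ℕ) : ℝ) / 2 - W)) (hφ0 : φ ≠ 0)
    (hHφ : heisenbergHamiltonian n G J *ᵥ φ =
      (((heisenbergHamiltonian n G J).groundEnergy : ℝ) : ℂ) • φ) :
    lowestEnergyInSector n (heisenbergHamiltonian n G J)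
      (((Fintype.card Λ * n : ℕ) : ℝ) / 2 - W) = (heisenbergHamiltonian n G J).groundEnergy := by
  have hW : ∃ σ : TensorIndex Λ (n + 1), (∑ z, (σ z : ℕ)) = W := by
    by_contra h
    push Not at h
    exact hφ0 (funext fun σ => (mem_spinZSector_weight_iff n W φ).1 hφ σ (h σ))
  exact le_antisymm (lowestEnergyInSector_le_of_eigenvector n G J W hφ hφ0 hHφ)
    (groundEnergy_le_lowestEnergyInSector n G J W hW)

end Graph

end QLattice

end LiebMattis

end Literature.MathematicalPhysics.QuantumLattice
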